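import Mathlib
import Literature.Barriers.ValiantsHypothesis.AlgebraicNaturalProofs
import Literature.Computability.AlgebraicComplexity.ArithCircuitProofs
import Summits.ValiantsHypothesis.ValiantsHypothesis.Theorems.BarrierLeverPartitionMinorsHitByVPStrataLeaves
import Summits.ValiantsHypothesis.ValiantsHypothesis.Theorems.BarrierLeverPartitionMinorsHitByVPCellDoor
import Summits.ValiantsHypothesis.ValiantsHypothesis.Theses.BarrierLever

/-!
# Route BarrierLever — item `PartitionMinorsHitByVP` (stmt-ValiantsHypothesis-19717):
# the CELL-LEAVES door of record (v4) — poly(h) power-diagram cells, each certified ⇒ item 19717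

Link file (`--supports stmt-ValiantsHypothesis-19717`; cell valiant-natproofs, rung V4, 𝒟-side,
prover seat val-np-p6 gen 2). Definition-free. Closes NO item; names the route decl only in the
conclusions of the two conditional links below.

The door of record v3 (`…StrataDoor.partitionMinorsHitByVP_of_strataLeaves`, p449543; leaf-agnostic
form `…partitionMinorsHitByVP_of_strataHit`, p451312) asks, eventually in `h`, for ONE threshold pair
`(λ, μ)` whose `≤ (h+h)^c` strata (intervals of `λ`-values matched to intervals of `μ`-values by an
injection `π`) are certified cells. This file replaces «intervals of one functional» by «cells of a
POWER DIAGRAM on each side» (`…StrataDoor.partitionMinor_hit_of_cells_perm`, p475102): row `i` lies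
in cell `lr i < m`, the strict argmax over `t < m` of the affine scores `kr t + Σ_{a ∈ u i} lam t a`;
column `j` in cell `lc j`, the strict argmax of `kc t + Σ_{c ∈ w j} mu t c`; a permutation `e` of
`Fin r` carries row cell `t` onto column cell `t`.

* **`partitionMinorsHitByVP_of_cellHit`** (leaf-agnostic, `b = c + c' + 3`): eventually in `h`,
  every injective layout has such a cell structure with `m ≤ (h+h)^c` cells, EACH CELL HIT by some
  member of `SmallCircuits ℂ (h+h) c'` ⇒ `Theses.BarrierLever.PartitionMinorsHitByVP`.
* **`partitionMinorsHitByVP_of_cellLeaves`** (`b = 2c + 6`): the same with the three concrete leaf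
  types of `…StrataDoor.stratum_hit` — SMALL (`≤ (h+h)^c` rows), PRODUCT-certified (one product
  state with arbitrary complex site tables), AUTOMORPHIC (`w (e i) = σ_t((u i) ∆ s_t)` on cell `t`).

WHY v4 IS WEAKER THAN v3 (informal; not needed below): the strata of v3 are the cells of the parallel
scores `lam t = 2t·λ`, `kr t = −Σ_{s<t}(2·cr(s+1)+1)` (`…StrataDoor.envelope_lt`) and, on the
column side, `mu t = 2π′(t)·μ`, `kc t = K′_{π′ t}` for any injective extension `π′` of `π` beyond the
occurring strata; conversely cells of unrelated functionals (e.g. lexicographic flattenings of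
threshold hierarchies whose inner thresholds depend on the outer stratum, `…StrataDoor.lex_strict`)
are not intervals of one functional. RESIDUE OF v4 = injective layouts all of whose power-diagram
cell structures with certified cells need super-polynomially many cells; as for v3 no member is
known, every census layout being a small leaf (`r ≤ (h+h)^2`); the random-like middle band
`r ≈ 2^{h/2}` (memo ADAPTIVE-WITNESSES-MEMO-g6 §1) is where a member would live.

WHAT THIS IS NOT: the cell-leaves hypothesis is OPEN; conditional links only; nothing on TT /
item 19616 / 19761, on crux 14610 or on VP vs VNP.
-/

set_option linter.dupNamespace false

namespace Summit.ValiantsHypothesis.ValiantsHypothesis.Theorems.BarrierLever.StrataDoor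

open Finset
open Literature.Barriers.ValiantsHypothesis Literature.Computability.AlgebraicComplexity
open Summit.ValiantsHypothesis.ValiantsHypothesis.Theorems.BarrierLever.SplitDoor (smallCircuits_mono)

/-- **Cell-hit ⇒ item 19717** (leaf-agnostic, `b = c + c' + 3`): eventually in `h`, every injective
layout admits `m ≤ (h+h)^c` power-diagram cells (strict argmax of affine scores on each side, row
cell `t` carried onto column cell `t` by a permutation `e`), each hit inside `SmallCircuits ℂ (h+h) c'`
⇒ `PartitionMinorsHitByVP`. -/
theorem partitionMinorsHitByVP_of_cellHit (c c' h₀ : ℕ)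
    (hcells : ∀ h : ℕ, h₀ ≤ h → ∀ (r : ℕ) (u w : Fin r → Finset (Fin h)),
      Function.Injective u → Function.Injective w →
      ∃ (m : ℕ) (lam mu : ℕ → Fin h → ℤ) (kr kc : ℕ → ℤ) (lr lc : Fin r → ℕ)
        (e : Equiv.Perm (Fin r)),
        m ≤ (h + h) ^ c ∧ (∀ i, lc (e i) = lr i) ∧ (∀ i, lr i < m) ∧
        (∀ i, ∀ t < m, t ≠ lr i →
          kr t + ∑ a ∈ u i, lam t a < kr (lr i) + ∑ a ∈ u i, lam (lr i) a) ∧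
        (∀ j, ∀ t < m, t ≠ lc j →
          kc t + ∑ c ∈ w j, mu t c < kc (lc j) + ∑ c ∈ w j, mu (lc j) c) ∧
        ∀ t < m, ∃ g ∈ SmallCircuits ℂ (h + h) c', (Matrix.of fun i i' : {i // lr i = t} =>
          MvPolynomial.coeff (∑ a ∈ u i.1, Finsupp.single (Fin.castAdd h a) 1 +
            ∑ c ∈ w (e i'.1), Finsupp.single (Fin.natAdd h c) 1) g).det ≠ 0) :
    Summit.ValiantsHypothesis.ValiantsHypothesis.Theses.BarrierLever.PartitionMinorsHitByVP := by
  classical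
  refine ⟨c + c' + 3, max h₀ 1, fun h hh r u w hu hw => ?_⟩
  have hh1 : 1 ≤ h := (le_max_right _ _).trans hh
  obtain ⟨m, lam, mu, kr, kc, lr, lc, e, hm, he, hlr, hrow, hcol, hleaves⟩ :=
    hcells h ((le_max_left _ _).trans hh) r u w hu hw
  have hex : ∀ t, ∃ g : MvPolynomial (Fin (h + h)) ℂ, t < m →
      (g ∈ SmallCircuits ℂ (h + h) c' ∧ (Matrix.of fun i i' : {i // lr i = t} =>
        MvPolynomial.coeff (∑ a ∈ u i.1, Finsupp.single (Fin.castAdd h a) 1 +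
          ∑ c ∈ w (e i'.1), Finsupp.single (Fin.natAdd h c) 1) g).det ≠ 0) := by
    intro t
    by_cases ht : t < m
    · obtain ⟨g, hg, hd⟩ := hleaves t ht
      exact ⟨g, fun _ => ⟨hg, hd⟩⟩
    · exact ⟨0, fun h' => absurd h' ht⟩
  choose F hF using hex
  obtain ⟨f, hdeg, hsize, hne⟩ := partitionMinor_hit_of_cells_perm m u w lam mu kr kc lr lc e he hlr
    hrow hcol F (fun t ht => (hF t ht).2)
  refine ⟨f, ⟨?_, ?_⟩, hne⟩
  · exact hdeg.trans (Finset.sup_le fun t ht => (hF t (Finset.mem_range.mp ht)).1.1)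
  · refine hsize.trans ?_
    have h2 : 1 ≤ h + h := by omega
    calc ∑ t ∈ Finset.range m, complexity (F t) + m * (h + h + 2)
        ≤ ∑ _t ∈ Finset.range m, (h + h) ^ (c' + 2) + m * (h + h + 2) := by
          gcongr with t ht
          exact (hF t (Finset.mem_range.mp ht)).1.2.trans (Nat.pow_le_pow_right h2 (by omega))
      _ = m * ((h + h) ^ (c' + 2) + (h + h) + 2) := by
          rw [Finset.sum_const, Finset.card_range, smul_eq_mul]; ring
      _ ≤ (h + h) ^ (c + (c' + 2) + 1) := strata_budget c (c' + 2) m hh1 (by omega) hm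
      _ = (h + h) ^ (c + c' + 3) := by ring_nf

/-- **Cell-leaves ⇒ item 19717** (`b = 2c + 6`): as `partitionMinorsHitByVP_of_cellHit`, with every
cell a good leaf in the sense of `…StrataDoor.stratum_hit` — SMALL (`≤ (h+h)^c` rows), certified by
ONE PRODUCT STATE (arbitrary complex site tables), or AUTOMORPHIC (`w (e i) = σ_t((u i) ∆ s_t)` on
cell `t`). The door of record v3 (p449543: strata of one threshold pair) is the case of parallel
scores. -/
theorem partitionMinorsHitByVP_of_cellLeaves (c h₀ : ℕ)
    (hcells : ∀ h : ℕ, h₀ ≤ h → ∀ (r : ℕ) (u w : Fin r → Finset (Fin h)),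
      Function.Injective u → Function.Injective w →
      ∃ (m : ℕ) (lam mu : ℕ → Fin h → ℤ) (kr kc : ℕ → ℤ) (lr lc : Fin r → ℕ)
        (e : Equiv.Perm (Fin r)),
        m ≤ (h + h) ^ c ∧ (∀ i, lc (e i) = lr i) ∧ (∀ i, lr i < m) ∧
        (∀ i, ∀ t < m, t ≠ lr i →
          kr t + ∑ a ∈ u i, lam t a < kr (lr i) + ∑ a ∈ u i, lam (lr i) a) ∧
        (∀ j, ∀ t < m, t ≠ lc j →
          kc t + ∑ c ∈ w j, mu t c < kc (lc j) + ∑ c ∈ w j, mu (lc j) c) ∧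
        ∀ t < m, (Fintype.card {i // lr i = t} ≤ (h + h) ^ c ∨
          (∃ P : Fin h → Bool → Bool → ℂ, (Matrix.of fun i i' : {i // lr i = t} =>
            ∏ a : Fin h, P a (decide (a ∈ u i.1)) (decide (a ∈ w (e i'.1)))).det ≠ 0) ∨
          (∃ (σ : Equiv.Perm (Fin h)) (s : Finset (Fin h)),
            ∀ i : {i // lr i = t}, w (e i.1) = (symmDiff (u i.1) s).image σ))) :
    Summit.ValiantsHypothesis.ValiantsHypothesis.Theses.BarrierLever.PartitionMinorsHitByVP := by
  classical
  refine partitionMinorsHitByVP_of_cellHit c (c + 3) (max h₀ 4) fun h hh r u w hu hw => ?_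
  have hh4 : 4 ≤ h := (le_max_right _ _).trans hh
  obtain ⟨m, lam, mu, kr, kc, lr, lc, e, hm, he, hlr, hrow, hcol, hleaves⟩ :=
    hcells h ((le_max_left _ _).trans hh) r u w hu hw
  refine ⟨m, lam, mu, kr, kc, lr, lc, e, hm, he, hlr, hrow, hcol, fun t ht => ?_⟩
  exact stratum_hit c hh4 u w hu hw lr e t (hleaves t ht)

end Summit.ValiantsHypothesis.ValiantsHypothesis.Theorems.BarrierLever.StrataDoor
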